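import Summits.CriticalPhenomena.Ising3DConformalLimit.Theorems.LogPolarProxyProxyUniversalityRotation
import Summits.CriticalPhenomena.Ising3DConformalLimit.Theorems.LogPolarProxyProxyUniversalityLatticeForm
import Literature.MathematicalPhysics.QuantumFieldTheory.OSLorentzInvariance
import HarnessLib

/-!
# Crux `ProxyUniversality` (stmt-CriticalPhenomena-11288), line `registered` — ISOTROPY CONSEQUENCES

Route `LogPolarProxy`, sub-problem `Ising3DConformalLimit`; skeleton `Cruxes/ProxyUniversality/Lines/birth.lean`
(v4, one open stub LC_pin `stub_latticeComparison`). THEOREM-ONLY file (no definitions, no named facts).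

The finite log-polar proxy is EXACTLY invariant under the rotation by the mesh angle `δ_N = π/(N+1)` about
the `z`-axis (`proxyCorr_rotate`, `…Rotation.lean`). In the vocabulary of the tree's axial rotations
`planeRot 0 θ` of `ℝ³` (the mesh rotation is `planeRot 0 (-δ_N)`, `planeRot_zero_neg_eq`), iterated to all
multiples `planeRot 0 (-(m δ_N))` (`proxyCorr_planeRot_natMul`) and combined with `⌊ψ/δ_N⌋₊ δ_N → ψ`:

* `apply_planeRot_eq_of_proxyUniversality` — **the crux forces axial isotropy of every limit**: under
  `ProxyUniversality`, every non-degenerate pointwise scaling limit `(ρ, S)` of `criticalCorr 3` satisfies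
  `S n (planeRot 0 θ ∘ p) = S n p` for every angle `θ` and every injective off-axis `p` at whose rotate
  `S n` is continuous within `offAxis n` (general form `apply_planeRot_eq_of_tendstoLocallyUniformlyOn`);
  `apply_planeRot_ratMulPi_eq_of_proxyUniversality` — the same for the angles `-(a/b)π` WITHOUT continuity
  (along `N + 1 ∈ bℕ` the rotation is an exact symmetry). With the hyperoctahedral symmetry of `ℤ³` this
  upgrades to full `O(3)` invariance of continuous limits (`…IsotropyUpgrade.lean`).
* `tendstoLocallyUniformlyOn_rescaledCorrelator_planeRot_sub`, `asymptotic_azimuthal_invariance_of_latticeComparison`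
  — **limit-free**: the lattice comparison (fixed profile, resp. the registered `∃`-form LC_pin) forces
  `ρ(δ_N)ⁿ (G n ⌊planeRot 0 (-(m_N δ_N)) ∘ p / δ_N⌋ − G n ⌊p/δ_N⌋) → 0` locally uniformly off the axis for all
  multiples `m_N` with `m_N δ_N` bounded — a necessary condition for the open stub about the critical `ℤ³`
  correlators ALONE (no limit object; a target for the crux disprover).

References: R. C. Brower, G. T. Fleming, H. Neuberger, Phys. Lett. B 721 (2013) 299–305, pp. 4–6 (axial
rotations of the radial lattice; "O(3) cannot be approximated by growing finite subgroups" — here the exact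
rotations by `δ_N → 0` give a dense set of angles) [BrowerFlemingNeuberger2013]; P. Di Francesco,
P. Mathieu, D. Sénéchal, *Conformal Field Theory* (1997) §4.3.1 [FrancescoMathieuSenechal1997].
-/

noncomputable section

namespace Summit.CriticalPhenomena.Ising3DConformalLimit.Cruxes.ProxyUniversality.Birth

open scoped BigOperators Topology
open Filter Set Function
open Literature.Probability.LatticeModels
open Literature.MathematicalPhysics.QuantumFieldTheory (planeRot planeRot_apply)
open Summit.CriticalPhenomena.Ising3DConformalLimit.Theses.LogPolarProxy (ProxyUniversality)

/-! ## §1 The axial rotations `planeRot 0 θ` of `ℝ³` (about `e₃`, acting on the coordinates `0, 1`) -/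

/-- Coordinates of the axial rotation: `(cos θ x₀ + sin θ x₁, -sin θ x₀ + cos θ x₁, x₂)`. [folklore] -/
theorem planeRot_zero_apply_fin_three (θ : ℝ) (x : EuclideanSpace ℝ (Fin 3)) :
    planeRot (d := 2) 0 θ x 0 = Real.cos θ * x 0 + Real.sin θ * x 1 ∧
      planeRot (d := 2) 0 θ x 1 = -Real.sin θ * x 0 + Real.cos θ * x 1 ∧
      planeRot (d := 2) 0 θ x 2 = x 2 := by
  refine ⟨?_, ?_, ?_⟩
  · simp [planeRot_apply]
  · simp [planeRot_apply]
  · simp [planeRot_apply]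

/-- Two axial rotations with the same cosine and sine coincide (used for `2π`-periodicity). [folklore] -/
theorem planeRot_zero_eq_of_cos_eq_sin_eq {a b : ℝ} (hc : Real.cos a = Real.cos b)
    (hs : Real.sin a = Real.sin b) (x : EuclideanSpace ℝ (Fin 3)) :
    planeRot (d := 2) 0 a x = planeRot (d := 2) 0 b x := by
  ext j
  fin_cases j <;> simp [hc, hs]

/-- The axial rotation by `0` is the identity. [folklore] -/
theorem planeRot_zero_zero_apply (x : EuclideanSpace ℝ (Fin 3)) : planeRot (d := 2) 0 0 x = x := by
  ext j
  fin_cases j <;> simp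

/-- The group law of the axial rotations: `R(θ + φ) = R(θ) ∘ R(φ)`. [folklore] -/
theorem planeRot_zero_add_apply (θ φ : ℝ) (x : EuclideanSpace ℝ (Fin 3)) :
    planeRot (d := 2) 0 (θ + φ) x = planeRot (d := 2) 0 θ (planeRot (d := 2) 0 φ x) := by
  ext j
  fin_cases j
  · simp [Real.cos_add, Real.sin_add]
    ring
  · simp [Real.cos_add, Real.sin_add]
    ring
  · simp

/-- The mesh rotation of `…Rotation.lean` (written out with `!₂[…]`) is the axial rotation
`planeRot 0 (-δ)`. [folklore] -/
theorem planeRot_zero_neg_eq (δ : ℝ) (x : EuclideanSpace ℝ (Fin 3)) :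
    planeRot (d := 2) 0 (-δ) x =
      (!₂[Real.cos δ * x 0 - Real.sin δ * x 1, Real.sin δ * x 0 + Real.cos δ * x 1, x 2] :
        EuclideanSpace ℝ (Fin 3)) := by
  ext j
  fin_cases j
  · simp [Real.cos_neg, Real.sin_neg]
    ring
  · simp [Real.cos_neg, Real.sin_neg]
  · simp

/-- An axial rotation maps points off the `z`-axis to points off the `z`-axis. [folklore] -/
theorem not_onAxis_planeRot (θ : ℝ) {x : EuclideanSpace ℝ (Fin 3)} (hx : ¬ (x 0 = 0 ∧ x 1 = 0)) :
    ¬ (planeRot (d := 2) 0 θ x 0 = 0 ∧ planeRot (d := 2) 0 θ x 1 = 0) := by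
  obtain ⟨h0, h1, -⟩ := planeRot_zero_apply_fin_three θ x
  rintro ⟨ha, hb⟩
  rw [h0] at ha
  rw [h1] at hb
  have hc := Real.cos_sq_add_sin_sq θ
  refine hx ⟨?_, ?_⟩
  · have e : x 0 = Real.cos θ * (Real.cos θ * x 0 + Real.sin θ * x 1) -
        Real.sin θ * (-Real.sin θ * x 0 + Real.cos θ * x 1) := by
      linear_combination (-(x 0)) * hc
    rw [e, ha, hb]
    ring
  · have e : x 1 = Real.sin θ * (Real.cos θ * x 0 + Real.sin θ * x 1) +
        Real.cos θ * (-Real.sin θ * x 0 + Real.cos θ * x 1) := by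
      linear_combination (-(x 1)) * hc
    rw [e, ha, hb]
    ring

/-- Axial rotations preserve the convergence domain `offAxis n` (they are injective and preserve the
axis). [folklore] -/
theorem planeRot_mem_offAxis {n : ℕ} (θ : ℝ) {p : Fin n → EuclideanSpace ℝ (Fin 3)}
    (hp : p ∈ offAxis n) : (fun i => planeRot (d := 2) 0 θ (p i)) ∈ offAxis n :=
  ⟨(planeRot (d := 2) 0 θ).injective.comp hp.1, fun i => not_onAxis_planeRot θ (hp.2 i)⟩

/-- Joint continuity of `(a, p) ↦ planeRot 0 (-a) ∘ p` on `ℝ × (configurations)`. [folklore] -/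
theorem continuous_planeRot_neg_comp (n : ℕ) :
    Continuous fun q : ℝ × (Fin n → EuclideanSpace ℝ (Fin 3)) =>
      (fun i => planeRot (d := 2) 0 (-q.1) (q.2 i)) := by
  refine continuous_pi fun i => ?_
  have e : (fun q : ℝ × (Fin n → EuclideanSpace ℝ (Fin 3)) => planeRot (d := 2) 0 (-q.1) (q.2 i)) =
      fun q => (WithLp.toLp 2 (fun j : Fin 3 =>
        if j = 0 then Real.cos (-q.1) * q.2 i 0 + Real.sin (-q.1) * q.2 i 1
        else if j = 1 then -Real.sin (-q.1) * q.2 i 0 + Real.cos (-q.1) * q.2 i 1 else q.2 i j) :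
          EuclideanSpace ℝ (Fin 3)) := by
    funext q
    ext j
    fin_cases j <;> simp [planeRot_apply]
  rw [e]
  refine (PiLp.continuous_toLp 2 _).comp (continuous_pi fun j => ?_)
  have hc0 : Continuous fun q : ℝ × (Fin n → EuclideanSpace ℝ (Fin 3)) => q.2 i 0 :=
    (PiLp.continuous_apply 2 _ 0).comp ((continuous_apply i).comp continuous_snd)
  have hc1 : Continuous fun q : ℝ × (Fin n → EuclideanSpace ℝ (Fin 3)) => q.2 i 1 :=
    (PiLp.continuous_apply 2 _ 1).comp ((continuous_apply i).comp continuous_snd)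
  have hcj : Continuous fun q : ℝ × (Fin n → EuclideanSpace ℝ (Fin 3)) => q.2 i j :=
    (PiLp.continuous_apply 2 _ j).comp ((continuous_apply i).comp continuous_snd)
  have hcos : Continuous fun q : ℝ × (Fin n → EuclideanSpace ℝ (Fin 3)) => Real.cos (-q.1) :=
    Real.continuous_cos.comp (continuous_neg.comp continuous_fst)
  have hsin : Continuous fun q : ℝ × (Fin n → EuclideanSpace ℝ (Fin 3)) => Real.sin (-q.1) :=
    Real.continuous_sin.comp (continuous_neg.comp continuous_fst)
  split_ifs
  · exact (hcos.mul hc0).add (hsin.mul hc1)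
  · exact (hsin.neg.mul hc0).add (hcos.mul hc1)
  · exact hcj

/-- Continuity of `a ↦ planeRot 0 (-a) ∘ p` for a fixed configuration. [folklore] -/
theorem continuous_planeRot_neg_comp_left {n : ℕ} (p : Fin n → EuclideanSpace ℝ (Fin 3)) :
    Continuous fun a : ℝ => (fun i => planeRot (d := 2) 0 (-a) (p i)) := by
  have hf : Continuous fun a : ℝ => ((a, p) : ℝ × (Fin n → EuclideanSpace ℝ (Fin 3))) :=
    continuous_id.prodMk continuous_const
  have h := (continuous_planeRot_neg_comp n).comp hf
  exact h

/-- **`m_N δ_N → ψ`** for `m_N = ⌊ψ/δ_N⌋₊`, `ψ ≥ 0`, `δ_N = π/(N+1)`. [folklore] -/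
theorem tendsto_natFloor_mul_proxyMesh {ψ : ℝ} (hψ : 0 ≤ ψ) :
    Tendsto (fun N : ℕ => (⌊ψ / (Real.pi / ((N : ℝ) + 1))⌋₊ : ℝ) * (Real.pi / ((N : ℝ) + 1))) atTop
      (𝓝 ψ) := by
  have hδ0 : Tendsto (fun N : ℕ => Real.pi / ((N : ℝ) + 1)) atTop (𝓝 0) :=
    (tendsto_nhdsWithin_iff.1 tendsto_proxyMesh).1
  have hlow : Tendsto (fun N : ℕ => ψ - Real.pi / ((N : ℝ) + 1)) atTop (𝓝 ψ) := by
    simpa using (tendsto_const_nhds (x := ψ)).sub hδ0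
  refine tendsto_of_tendsto_of_tendsto_of_le_of_le hlow tendsto_const_nhds (fun N => ?_) fun N => ?_
  · have hδ : 0 < Real.pi / ((N : ℝ) + 1) := div_pos Real.pi_pos (Nat.cast_add_one_pos _)
    have h := Nat.lt_floor_add_one (ψ / (Real.pi / ((N : ℝ) + 1)))
    rw [div_lt_iff₀ hδ] at h
    linarith
  · have hδ : 0 < Real.pi / ((N : ℝ) + 1) := div_pos Real.pi_pos (Nat.cast_add_one_pos _)
    have h := Nat.floor_le (div_nonneg hψ hδ.le)
    rwa [le_div_iff₀ hδ] at h

/-! ## §2 Exact invariance of the renormalised proxy correlator under all multiples of the mesh angle -/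

section Proxy

variable (Jr Jt Jp : ℕ → ℕ → ℝ) (A : ℕ → ℝ → ℝ) (ρ : ℝ → ℝ) (N n : ℕ)

/-- `proxyCorr_rotate` in the `planeRot` vocabulary: the renormalised proxy correlator is invariant under
`planeRot 0 (-δ_N)` on off-axis configurations. [cite: BrowerFlemingNeuberger2013, p. 4] -/
theorem proxyCorr_planeRot_mesh (p : Fin n → EuclideanSpace ℝ (Fin 3))
    (hp : ∀ i, ¬ (p i 0 = 0 ∧ p i 1 = 0)) :
    proxyCorr Jr Jt Jp A ρ N n (fun i => planeRot (d := 2) 0 (-(Real.pi / ((N : ℝ) + 1))) (p i)) =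
      proxyCorr Jr Jt Jp A ρ N n p := by
  rw [← proxyCorr_rotate Jr Jt Jp A ρ N n p hp]
  congr 1
  funext i
  exact planeRot_zero_neg_eq _ _

/-- **Exact invariance under every multiple of the mesh angle**: for every `m : ℕ`,
`proxyCorr (planeRot 0 (-(m δ_N)) ∘ p) = proxyCorr p` on off-axis configurations. [cite: BrowerFlemingNeuberger2013, p. 4] -/
theorem proxyCorr_planeRot_natMul (m : ℕ) :
    ∀ p : Fin n → EuclideanSpace ℝ (Fin 3), (∀ i, ¬ (p i 0 = 0 ∧ p i 1 = 0)) →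
      proxyCorr Jr Jt Jp A ρ N n
          (fun i => planeRot (d := 2) 0 (-((m : ℝ) * (Real.pi / ((N : ℝ) + 1)))) (p i)) =
        proxyCorr Jr Jt Jp A ρ N n p := by
  induction m with
  | zero =>
    intro p _
    simp only [Nat.cast_zero, zero_mul, neg_zero, planeRot_zero_zero_apply]
  | succ m ih =>
    intro p hp
    have hq : ∀ i, ¬ (planeRot (d := 2) 0 (-((m : ℝ) * (Real.pi / ((N : ℝ) + 1)))) (p i) 0 = 0 ∧
        planeRot (d := 2) 0 (-((m : ℝ) * (Real.pi / ((N : ℝ) + 1)))) (p i) 1 = 0) :=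
      fun i => not_onAxis_planeRot _ (hp i)
    have e : (fun i => planeRot (d := 2) 0 (-(((m + 1 : ℕ) : ℝ) * (Real.pi / ((N : ℝ) + 1)))) (p i)) =
        fun i => planeRot (d := 2) 0 (-(Real.pi / ((N : ℝ) + 1)))
          (planeRot (d := 2) 0 (-((m : ℝ) * (Real.pi / ((N : ℝ) + 1)))) (p i)) := by
      funext i
      rw [← planeRot_zero_add_apply]
      congr 1
      push_cast
      ring
    rw [e, proxyCorr_planeRot_mesh Jr Jt Jp A ρ N n _ hq, ih p hp]

end Proxy

/-! ## §3 Axial rotation invariance of limits of exactly mesh-rotation-invariant sequences -/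

/-- **General form.** If `F_N → f` locally uniformly on `offAxis n`, each `F_N` is invariant under the
rotations `planeRot 0 (-(m δ_N))`, `m : ℕ`, on off-axis configurations, and `f` is continuous within
`offAxis n` at the rotate `planeRot 0 θ ∘ p` of an off-axis configuration `p`, then
`f (planeRot 0 θ ∘ p) = f p`: write `planeRot 0 θ = planeRot 0 (-ψ)` with `ψ ≥ 0` (`2π`-periodicity),
approximate `ψ` by `m_N δ_N`, `m_N = ⌊ψ/δ_N⌋₊`, and compare the limits of `F_N p` and
`F_N (planeRot 0 (-(m_N δ_N)) ∘ p) = F_N p` (`TendstoLocallyUniformlyOn.tendsto_comp`). [folklore] -/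
theorem apply_planeRot_eq_of_tendstoLocallyUniformlyOn {n : ℕ}
    {F : ℕ → (Fin n → EuclideanSpace ℝ (Fin 3)) → ℝ} {f : (Fin n → EuclideanSpace ℝ (Fin 3)) → ℝ}
    (hF : TendstoLocallyUniformlyOn F f atTop (offAxis n))
    (hinv : ∀ (N m : ℕ) (p : Fin n → EuclideanSpace ℝ (Fin 3)), (∀ i, ¬ (p i 0 = 0 ∧ p i 1 = 0)) →
      F N (fun i => planeRot (d := 2) 0 (-((m : ℝ) * (Real.pi / ((N : ℝ) + 1)))) (p i)) = F N p)
    (θ : ℝ) {p : Fin n → EuclideanSpace ℝ (Fin 3)} (hp : p ∈ offAxis n)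
    (hcont : ContinuousWithinAt f (offAxis n) (fun i => planeRot (d := 2) 0 θ (p i))) :
    f (fun i => planeRot (d := 2) 0 θ (p i)) = f p := by
  -- normalise the angle: `θ ≡ -ψ (mod 2π)` with `ψ ≥ 0`
  set ψ : ℝ := (⌈θ / (2 * Real.pi)⌉ : ℝ) * (2 * Real.pi) - θ with hψdef
  have hψ : 0 ≤ ψ := by
    have h := Int.le_ceil (θ / (2 * Real.pi))
    rw [div_le_iff₀ (by positivity)] at h
    linarith
  have hper : ∀ x : EuclideanSpace ℝ (Fin 3), planeRot (d := 2) 0 θ x = planeRot (d := 2) 0 (-ψ) x := by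
    intro x
    refine planeRot_zero_eq_of_cos_eq_sin_eq ?_ ?_ x
    · rw [show -ψ = θ - (⌈θ / (2 * Real.pi)⌉ : ℝ) * (2 * Real.pi) by rw [hψdef]; ring,
        Real.cos_sub_int_mul_two_pi]
    · rw [show -ψ = θ - (⌈θ / (2 * Real.pi)⌉ : ℝ) * (2 * Real.pi) by rw [hψdef]; ring,
        Real.sin_sub_int_mul_two_pi]
  have hrot : (fun i => planeRot (d := 2) 0 θ (p i)) = fun i => planeRot (d := 2) 0 (-ψ) (p i) :=
    funext fun i => hper (p i)
  rw [hrot] at hcont ⊢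
  -- the approximating exact symmetries
  set m : ℕ → ℕ := fun N => ⌊ψ / (Real.pi / ((N : ℝ) + 1))⌋₊ with hmdef
  set g : ℕ → (Fin n → EuclideanSpace ℝ (Fin 3)) := fun N i =>
    planeRot (d := 2) 0 (-((m N : ℝ) * (Real.pi / ((N : ℝ) + 1)))) (p i) with hgdef
  have hmem : (fun i => planeRot (d := 2) 0 (-ψ) (p i)) ∈ offAxis n := planeRot_mem_offAxis _ hp
  have hg : Tendsto g atTop (𝓝[offAxis n] fun i => planeRot (d := 2) 0 (-ψ) (p i)) := by
    refine tendsto_nhdsWithin_iff.2 ⟨?_, Eventually.of_forall fun N => planeRot_mem_offAxis _ hp⟩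
    have hc := (continuous_planeRot_neg_comp_left p).tendsto ψ
    exact hc.comp (tendsto_natFloor_mul_proxyMesh hψ)
  have h1 : Tendsto (fun N => F N (g N)) atTop (𝓝 (f fun i => planeRot (d := 2) 0 (-ψ) (p i))) :=
    hF.tendsto_comp hcont hmem hg
  have h2 : (fun N => F N (g N)) = fun N => F N p := funext fun N => hinv N (m N) p hp.2
  rw [h2] at h1
  exact tendsto_nhds_unique h1 (hF.tendsto_at hp)

/-- **The crux forces axial rotation invariance of every limit.** If `ProxyUniversality` holds, then
for every renormalisation `ρ > 0` on `(0,1]` and every non-degenerate pointwise scaling limit `S` of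
`criticalCorr 3`, every order `n`, every angle `θ` and every injective off-axis configuration `p` such
that `S n` is continuous within `offAxis n` at `planeRot 0 θ ∘ p`:
`S n (planeRot 0 θ ∘ p) = S n p`. (The proxy correlators realising `S n` are exactly invariant under
the rotations by multiples of `δ_N → 0`.) [cite: BrowerFlemingNeuberger2013, pp. 4–6] -/
theorem apply_planeRot_eq_of_proxyUniversality :
    ProxyUniversality → ∀ (ρ : ℝ → ℝ) (S : CorrFamily 3), (∀ δ ∈ Set.Ioc (0:ℝ) 1, 0 < ρ δ) →
      HasPointwiseScalingLimit (criticalCorr 3) ρ S → IsNondegenerateTwoPoint S →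
      ∀ (n : ℕ) (θ : ℝ) (p : Fin n → EuclideanSpace ℝ (Fin 3)), p ∈ offAxis n →
        ContinuousWithinAt (S n) (offAxis n)
            (fun i => Literature.MathematicalPhysics.QuantumFieldTheory.planeRot (d := 2) 0 θ (p i)) →
          S n (fun i => Literature.MathematicalPhysics.QuantumFieldTheory.planeRot (d := 2) 0 θ (p i)) =
            S n p := by
  intro h ρ S hρ hlim hnd n θ p hp hcont
  obtain ⟨Jr, Jt, Jp, A, -, -, hconv⟩ := proxyUniversality_iff.1 h ρ S hρ hlim hnd
  exact apply_planeRot_eq_of_tendstoLocallyUniformlyOn (hconv n)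
    (fun N m q hq => proxyCorr_planeRot_natMul Jr Jt Jp A ρ N n m q hq) θ hp hcont

/-- **Rational multiples of `π`, no continuity.** If `ProxyUniversality` holds, then for every
non-degenerate pointwise scaling limit `(ρ, S)` of `criticalCorr 3`, all `a b : ℕ` with `0 < b`, every `n`
and every injective off-axis configuration `p`: `S n (planeRot 0 (-(a/b·π)) ∘ p) = S n p` — along the
resolutions `N = b(k+1) - 1` the angle `(a/b)π = (a(k+1)) δ_N` is an exact symmetry of the proxy, and
both sides are limits of the same subsequence. [cite: BrowerFlemingNeuberger2013, pp. 4–6] -/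
theorem apply_planeRot_ratMulPi_eq_of_proxyUniversality :
    ProxyUniversality → ∀ (ρ : ℝ → ℝ) (S : CorrFamily 3), (∀ δ ∈ Set.Ioc (0:ℝ) 1, 0 < ρ δ) →
      HasPointwiseScalingLimit (criticalCorr 3) ρ S → IsNondegenerateTwoPoint S →
      ∀ (n a b : ℕ), 0 < b → ∀ p : Fin n → EuclideanSpace ℝ (Fin 3), p ∈ offAxis n →
        S n (fun i => Literature.MathematicalPhysics.QuantumFieldTheory.planeRot (d := 2) 0
            (-((a : ℝ) / b * Real.pi)) (p i)) = S n p := by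
  intro h ρ S hρ hlim hnd n a b hb p hp
  obtain ⟨Jr, Jt, Jp, A, -, -, hconv⟩ := proxyUniversality_iff.1 h ρ S hρ hlim hnd
  -- the resolutions `N_k = b(k+1) - 1`, along which `(a/b)π = (a(k+1)) δ_{N_k}`
  set Nk : ℕ → ℕ := fun k => b * (k + 1) - 1 with hNk
  have hcast : ∀ k : ℕ, ((Nk k : ℕ) : ℝ) + 1 = (b : ℝ) * ((k : ℝ) + 1) := by
    intro k
    have h1 : 1 ≤ b * (k + 1) := Nat.one_le_iff_ne_zero.2 (Nat.mul_ne_zero hb.ne' (Nat.succ_ne_zero k))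
    have : ((b * (k + 1) - 1 : ℕ) : ℝ) = (b : ℝ) * ((k : ℝ) + 1) - 1 := by
      rw [Nat.cast_sub h1]
      push_cast
      ring
    rw [hNk, this]
    ring
  have hangle : ∀ k : ℕ, ((a * (k + 1) : ℕ) : ℝ) * (Real.pi / (((Nk k : ℕ) : ℝ) + 1)) =
      (a : ℝ) / b * Real.pi := by
    intro k
    rw [hcast]
    have hb' : (b : ℝ) ≠ 0 := Nat.cast_ne_zero.2 hb.ne'
    have hk' : (k : ℝ) + 1 ≠ 0 := (Nat.cast_add_one_pos k).ne'
    push_cast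
    field_simp
  have hNk_tendsto : Tendsto Nk atTop atTop := by
    refine tendsto_atTop_mono (fun k => ?_) tendsto_id
    show k ≤ b * (k + 1) - 1
    have : k + 1 ≤ b * (k + 1) := Nat.le_mul_of_pos_left (k + 1) hb
    omega
  have hmem : (fun i => planeRot (d := 2) 0 (-((a : ℝ) / b * Real.pi)) (p i)) ∈ offAxis n :=
    planeRot_mem_offAxis _ hp
  -- both values are limits of the same subsequence of proxy correlators
  have h1 : Tendsto (fun k => proxyCorr Jr Jt Jp A ρ (Nk k) n
      (fun i => planeRot (d := 2) 0 (-((a : ℝ) / b * Real.pi)) (p i))) atTop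
      (𝓝 (S n fun i => planeRot (d := 2) 0 (-((a : ℝ) / b * Real.pi)) (p i))) :=
    ((hconv n).tendsto_at hmem).comp hNk_tendsto
  have h2 : Tendsto (fun k => proxyCorr Jr Jt Jp A ρ (Nk k) n p) atTop (𝓝 (S n p)) :=
    ((hconv n).tendsto_at hp).comp hNk_tendsto
  have h3 : (fun k => proxyCorr Jr Jt Jp A ρ (Nk k) n
      (fun i => planeRot (d := 2) 0 (-((a : ℝ) / b * Real.pi)) (p i))) =
      fun k => proxyCorr Jr Jt Jp A ρ (Nk k) n p := by
    funext k
    rw [← hangle k]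
    exact proxyCorr_planeRot_natMul Jr Jt Jp A ρ (Nk k) n (a * (k + 1)) p hp.2
  rw [h3] at h1
  exact tendsto_nhds_unique h1 h2

end Summit.CriticalPhenomena.Ising3DConformalLimit.Cruxes.ProxyUniversality.Birth

end
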